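import Mathlib.LinearAlgebra.Charpoly.Basic
import Mathlib.Algebra.Polynomial.Inductions
import Mathlib.LinearAlgebra.FreeModule.Finite.Basic
import HarnessLib

/-!
# Kernel vectors from minimal annihilating polynomials (the last step of Wiedemann's algorithm)

D. H. Wiedemann, *Solving sparse linear equations over finite fields*, IEEE Trans. Inform. Theory
32 (1986) 54–62, §II–III: to find a non-zero solution of `A w = 0` for a singular `A`, one computes
(via the Berlekamp–Massey algorithm applied to the scalar sequences `uᵀ Aⁱ b`) the minimal
polynomial `m_b` of a vector `b` with respect to `A` — the monic generator of
`{p ∈ F[X] : p(A) b = 0}` — and, when `m_b(0) = 0`, i.e. `m_b = X · q`, outputs `w = q(A) b`: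
then `w ≠ 0` (by minimality of `m_b`) and `A w = m_b(A) b = 0`. This is the linear-algebra step
of Lenstra–Pomerance's Algorithm 10.1, Step 5 ("by means of the coordinate recurrence method
of [34] one finds a nontrivial dependency"), J. Amer. Math. Soc. **5** (1992) p. 507.

We prove the deterministic core for an endomorphism `A` of a vector space `V` over a field `F`:

* `exists_minimal_annihilator` — in finite dimension every `b` has a non-zero annihilating
  polynomial of minimal degree (Cayley–Hamilton, Mathlib's `LinearMap.aeval_self_charpoly`);
* `kernel_vector_of_minimal_annihilator` — if `p ≠ 0` annihilates `b` (`p(A) b = 0`), has minimal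
  degree among such polynomials, and `p(0) = 0`, then `w = (p/X)(A) b` is a non-zero vector with
  `A w = 0`.

Everything is proved; Mathlib has `Polynomial.divX`, `Module.End` and `LinearMap.charpoly` but no
Krylov/Wiedemann material.

## References

* D. H. Wiedemann, IEEE Trans. Inform. Theory 32 (1986) 54–62, §II (the minimal polynomial of a
  sequence / of `b`), §III (singular case).
* H. W. Lenstra Jr., C. Pomerance, J. Amer. Math. Soc. 5 (1992) 483–516, §10, Algorithm 10.1
  Step 5. [LenstraPomerance1992]
-/

namespace Literature.LinearAlgebra

open Polynomial

variable {F V : Type*} [Field F] [AddCommGroup V] [Module F V]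

/-- **Kernel extraction (Wiedemann).** Let `A` be an endomorphism, `b` a vector, and `p ≠ 0` a
polynomial of minimal degree with `p(A) b = 0`. If `p(0) = 0` then `w = (p/X)(A) b ≠ 0` and
`A w = 0`. [cite: LenstraPomerance1992, §10 Algorithm 10.1 Step 5] -/
theorem kernel_vector_of_minimal_annihilator (A : Module.End F V) (b : V) {p : F[X]} (hp0 : p ≠ 0)
    (hpb : aeval A p b = 0)
    (hmin : ∀ q : F[X], q ≠ 0 → aeval A q b = 0 → p.natDegree ≤ q.natDegree)
    (hc : p.coeff 0 = 0) :
    aeval A p.divX b ≠ 0 ∧ A (aeval A p.divX b) = 0 := by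
  have hXp : X * p.divX = p := by
    have h := X_mul_divX_add p
    rwa [hc, C_0, add_zero] at h
  have hdivX0 : p.divX ≠ 0 := by
    intro h0
    apply hp0
    rw [← hXp, h0, mul_zero]
  constructor
  · intro hw
    -- `p.divX` annihilates `b` and has smaller degree
    have hdeg : p.divX.natDegree < p.natDegree := by
      rw [natDegree_divX_eq_natDegree_tsub_one]
      have h1 : p.natDegree ≠ 0 := by
        intro h0
        apply hp0
        rw [eq_C_of_natDegree_eq_zero h0, hc, C_0]
      omega
    exact absurd (hmin p.divX hdivX0 hw) (not_le.2 hdeg)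
  · have h : A (aeval A p.divX b) = aeval A (X * p.divX) b := by
      rw [map_mul, aeval_X, Module.End.mul_apply]
    rw [h, hXp, hpb]

/-- In finite dimension every vector has a non-zero annihilating polynomial of minimal degree
(the characteristic polynomial of `A` annihilates everything). [folklore] -/
theorem exists_minimal_annihilator [FiniteDimensional F V] (A : Module.End F V) (b : V) :
    ∃ p : F[X], p ≠ 0 ∧ aeval A p b = 0 ∧
      ∀ q : F[X], q ≠ 0 → aeval A q b = 0 → p.natDegree ≤ q.natDegree := by
  classical
  have hex : ∃ n : ℕ, ∃ p : F[X], p ≠ 0 ∧ aeval A p b = 0 ∧ p.natDegree = n := by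
    refine ⟨A.charpoly.natDegree, A.charpoly, A.charpoly_monic.ne_zero, ?_, rfl⟩
    rw [LinearMap.aeval_self_charpoly, LinearMap.zero_apply]
  obtain ⟨p, hp0, hpb, hpn⟩ := Nat.find_spec hex
  refine ⟨p, hp0, hpb, fun q hq0 hqb => ?_⟩
  rw [hpn]
  exact Nat.find_min' hex ⟨q, hq0, hqb, rfl⟩

/-- **Wiedemann's singular case, deterministic form**: if the minimal annihilating polynomial of
`b ≠ 0` (any minimal-degree non-zero annihilator) vanishes at `0`, a non-zero kernel vector of `A`
is obtained as `(p/X)(A) b`. [cite: LenstraPomerance1992, §10 Algorithm 10.1 Step 5] -/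
theorem exists_ne_zero_mem_ker_of_annihilator_coeff_zero [FiniteDimensional F V] (A : Module.End F V)
    (b : V) (h : ∀ p : F[X], p ≠ 0 → aeval A p b = 0 →
      (∀ q : F[X], q ≠ 0 → aeval A q b = 0 → p.natDegree ≤ q.natDegree) → p.coeff 0 = 0) :
    ∃ w : V, w ≠ 0 ∧ A w = 0 := by
  obtain ⟨p, hp0, hpb, hmin⟩ := exists_minimal_annihilator A b
  obtain ⟨hw, hAw⟩ := kernel_vector_of_minimal_annihilator A b hp0 hpb hmin (h p hp0 hpb hmin)
  exact ⟨_, hw, hAw⟩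

end Literature.LinearAlgebra
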